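import Mathlib.Combinatorics.SimpleGraph.Walk.Counting
import Mathlib.Combinatorics.SimpleGraph.Paths
import Mathlib.Topology.Algebra.InfiniteSum.Constructions
import Mathlib.Topology.Algebra.InfiniteSum.ENNReal
import Summits.CriticalPhenomena.SAWScalingLimit.Theorems.SAWTotalPositivityBoundaryTP2Defs
import HarnessLib

/-!
# Crux `BoundaryTP2` (stmt-CriticalPhenomena-7115), line `Sketch`: factorisation across a two-edge cut

For the fugacity-`x` self-avoiding path kernel `Z_H(a,b) = pathKernel H x a b = Σ_{γ : a → b} x^{|γ|}`
and a vertex set `A` left by exactly two oriented edges `e₁e₂`, `f₁f₂` of `H` (`e₁, f₁ ∈ A`,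
`e₂, f₂ ∉ A`), every self-avoiding path from `a ∈ A` to `b ∉ A` crosses the cut exactly once — a
return into `A` followed by a second exit would use three distinct cut edges — through `e` or through
`f`, and splits uniquely as (path `a → e₁` inside `A`) · `e₁e₂` · (path `e₂ → b` inside `Aᶜ`)
(resp. `f`). Hence

`Z_H(a,b) = x · (Z_A(a,e₁) Z_{Aᶜ}(e₂,b) + Z_A(a,f₁) Z_{Aᶜ}(f₂,b))`,

where `Z_A`, `Z_{Aᶜ}` are the kernels of the graphs `SimpleGraph.fromRel (H.Adj u v ∧ u ∈ A ∧ v ∈ A)`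
and `SimpleGraph.fromRel (H.Adj u v ∧ u ∉ A ∧ v ∉ A)` (`stub_twoEdgeCut_factor`, a registered stub of
the line's skeleton: "TP₂ is multiplicative across 2-edge bottlenecks"). The proof is a bijection
between `H.Path a b` and the disjoint sum of the two products of path types, transported along
`Function.Injective.tsum_eq`, then `Summable.tsum_sum`, `ENNReal.tsum_prod'` and
`ENNReal.tsum_mul_left/right`. All sums are unconditional sums in `ℝ≥0∞`; no finiteness is needed.
Everything here is proved; Mathlib only. [folklore]
-/

noncomputable section

namespace Summit.CriticalPhenomena.SAWScalingLimit.Theorems.BoundaryTP2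

open scoped ENNReal

variable {V : Type*}

/-! ## Walks confined to one side of a cut -/

/-- If every edge of `G` ends in `P`, a walk of `G` that starts in `P` stays in `P`. [folklore] -/
private theorem forall_mem_support {G : SimpleGraph V} {P : V → Prop}
    (hG : ∀ u v, G.Adj u v → P v) {u v : V} (p : G.Walk u v) (hu : P u) :
    ∀ z ∈ p.support, P z := by
  induction p with
  | nil =>
    intro z hz
    rw [SimpleGraph.Walk.support_nil, List.mem_singleton] at hz
    exact hz ▸ hu
  | cons h q ih =>
    intro z hz
    rw [SimpleGraph.Walk.support_cons, List.mem_cons] at hz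
    rcases hz with rfl | hz
    · exact hu
    · exact ih (hG _ _ h) z hz

/-- The edges of a walk of `H` all of whose vertices satisfy `P` are edges of any graph `G` containing
the `P`-internal edges of `H`. [folklore] -/
private theorem edges_mem_of_support {H G : SimpleGraph V} {P : V → Prop}
    (hG : ∀ u v, H.Adj u v → P u → P v → G.Adj u v) {u v : V} (p : H.Walk u v)
    (hp : ∀ z ∈ p.support, P z) : ∀ e, e ∈ p.edges → e ∈ G.edgeSet := by
  induction p with
  | nil => intro e he; simp at he
  | cons h q ih =>
    intro e he
    rw [SimpleGraph.Walk.edges_cons, List.mem_cons] at he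
    rcases he with rfl | he
    · exact (SimpleGraph.mem_edgeSet G).2 (hG _ _ h (hp _ (by simp)) (hp _ (by simp)))
    · exact ih (fun z hz => hp z (by simp [hz])) e he

/-- The edges of a walk of a subgraph `G ≤ H` are edges of `H`. [folklore] -/
private theorem edges_mem_of_le {G H : SimpleGraph V} (hle : G ≤ H) {u v : V} (p : G.Walk u v) :
    ∀ e, e ∈ p.edges → e ∈ H.edgeSet :=
  fun _ he => SimpleGraph.edgeSet_mono hle (p.edges_subset_edgeSet he)

/-- **One permitted cut edge.** A trail of `H` between two vertices outside `A` whose cut edges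
(oriented `A → Aᶜ`) can only be the single edge `g₁g₂` never enters `A`: entering and leaving again
would use that edge twice. [folklore] -/
private theorem forall_notMem_of_isTrail {H : SimpleGraph V} {A : Set V} {g₁ g₂ d : V}
    (hd : d ∉ A) : ∀ {c : V} (w : H.Walk c d), w.IsTrail → c ∉ A →
      (∀ u v, H.Adj u v → u ∈ A → v ∉ A → s(u, v) ∈ w.edges → u = g₁ ∧ v = g₂) →
      ∀ z ∈ w.support, z ∉ A := by
  intro c w
  induction w with
  | nil =>
    intro _ hc _ z hz
    rw [SimpleGraph.Walk.support_nil, List.mem_singleton] at hz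
    exact hz ▸ hc
  | @cons c c' _ h w' ih =>
    intro hw hc hyp z hz
    rw [SimpleGraph.Walk.isTrail_cons] at hw
    by_cases hc' : c' ∈ A
    · -- the first step enters `A` along the cut edge, so `c' = g₁`, `c = g₂`; the walk must leave `A`
      -- again (its end `d` is outside), necessarily along `g₁g₂`: that edge is used twice.
      exfalso
      have hcg : c' = g₁ ∧ c = g₂ := hyp c' c h.symm hc' hc (by simp [Sym2.eq_swap])
      obtain ⟨e, he, hefst, hesnd⟩ := w'.exists_boundary_dart A hc' hd
      have hmem : e.edge ∈ w'.edges := List.mem_map.2 ⟨e, he, rfl⟩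
      have heg : e.fst = g₁ ∧ e.snd = g₂ :=
        hyp e.fst e.snd e.adj hefst hesnd (List.mem_cons_of_mem _ hmem)
      have key : e.edge = s(c, c') := by
        show s(e.fst, e.snd) = s(c, c')
        rw [heg.1, heg.2, Sym2.eq_swap]
        show s(g₂, g₁) = s(c, c')
        rw [hcg.1, hcg.2]
      rw [key] at hmem
      exact hw.2 hmem
    · rw [SimpleGraph.Walk.support_cons, List.mem_cons] at hz
      rcases hz with rfl | hz
      · exact hc
      · exact ih hd hw.1 hc' (fun u v huv hu hv hm => hyp u v huv hu hv (List.mem_cons_of_mem _ hm))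
          z hz

/-! ## Splitting a path at its unique cut edge -/

/-- **Existence of the splitting.** If the only oriented edges leaving `A` are `e₁e₂` and `f₁f₂`, a
self-avoiding path of `H` from `a ∈ A` to `b ∉ A` is `p · uv · q` for a cut edge `uv`, a self-avoiding
`p : a → u` using only edges inside `A` and a self-avoiding `q : v → b` using only edges inside `Aᶜ`
(after the first crossing the path cannot return: both remaining crossings would be needed). Here
`GA ⊇ H[A]`-edges and `GB ⊇ H[Aᶜ]`-edges are subgraphs of `H`. [folklore] -/
private theorem exists_split {H GA GB : SimpleGraph V} {A : Set V} {e₁ e₂ f₁ f₂ b : V}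
    (hcut : ∀ u v, H.Adj u v → u ∈ A → v ∉ A → (u = e₁ ∧ v = e₂) ∨ (u = f₁ ∧ v = f₂))
    (hAle : GA ≤ H) (hBle : GB ≤ H)
    (hA : ∀ u v, H.Adj u v → u ∈ A → v ∈ A → GA.Adj u v)
    (hB : ∀ u v, H.Adj u v → u ∉ A → v ∉ A → GB.Adj u v) (hb : b ∉ A) :
    ∀ {a : V} (w : H.Walk a b), w.IsPath → a ∈ A →
      ∃ (u v : V) (huv : H.Adj u v) (p : GA.Walk a u) (q : GB.Walk v b),
        u ∈ A ∧ v ∉ A ∧ p.IsPath ∧ q.IsPath ∧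
          w = (p.transfer H (edges_mem_of_le hAle p)).append
            (SimpleGraph.Walk.cons huv (q.transfer H (edges_mem_of_le hBle q))) := by
  intro a w
  induction w with
  | nil => intro _ ha; exact absurd ha hb
  | @cons a c _ h w' ih =>
    intro hw ha
    rw [SimpleGraph.Walk.cons_isPath_iff] at hw
    by_cases hc : c ∈ A
    · -- the first edge stays inside `A`: prepend it to the splitting of the tail
      obtain ⟨u, v, huv, p, q, hu, hv, hp, hq, hw'⟩ := ih hb hw.1 hc
      refine ⟨u, v, huv, SimpleGraph.Walk.cons (hA a c h ha hc) p, q, hu, hv, ?_, hq, ?_⟩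
      · rw [SimpleGraph.Walk.cons_isPath_iff]
        refine ⟨hp, fun hap => hw.2 ?_⟩
        rw [hw', SimpleGraph.Walk.support_append, SimpleGraph.Walk.support_transfer]
        exact List.mem_append_left _ hap
      · rw [hw']
        rfl
    · -- the first edge `ac` crosses the cut; the tail avoids `a`, hence the edge `ac`, so it could only
      -- cross back along the other cut edge, and `forall_notMem_of_isTrail` keeps it inside `Aᶜ`.
      have hstay : ∀ z ∈ w'.support, z ∉ A := by
        rcases hcut a c h ha hc with ⟨rfl, rfl⟩ | ⟨rfl, rfl⟩
        · refine forall_notMem_of_isTrail (g₁ := f₁) (g₂ := f₂) hb w' hw.1.isTrail hc ?_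
          intro u v huv hu hv hmem
          rcases hcut u v huv hu hv with ⟨rfl, rfl⟩ | huv'
          · exact absurd (w'.fst_mem_support_of_mem_edges hmem) hw.2
          · exact huv'
        · refine forall_notMem_of_isTrail (g₁ := e₁) (g₂ := e₂) hb w' hw.1.isTrail hc ?_
          intro u v huv hu hv hmem
          rcases hcut u v huv hu hv with huv' | ⟨rfl, rfl⟩
          · exact huv'
          · exact absurd (w'.fst_mem_support_of_mem_edges hmem) hw.2
      refine ⟨a, c, h, SimpleGraph.Walk.nil, w'.transfer GB (edges_mem_of_support hB w' hstay), ha, hc,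
        SimpleGraph.Walk.IsPath.nil, hw.1.transfer _, ?_⟩
      simp only [SimpleGraph.Walk.transfer, SimpleGraph.Walk.nil_append,
        SimpleGraph.Walk.transfer_transfer, SimpleGraph.Walk.transfer_self]

/-- **Uniqueness of the splitting.** Two factorisations `p₁ · u₁v₁ · q₁ = p₂ · u₂v₂ · q₂` of one walk
with `p₁`, `p₂` inside `A` and `v₁, v₂ ∉ A` coincide: the cut edge is the first step out of `A`.
[folklore] -/
private theorem split_unique {H : SimpleGraph V} {A : Set V} {b : V} :
    ∀ {a u₁ v₁ u₂ v₂ : V} (p₁ : H.Walk a u₁) (p₂ : H.Walk a u₂) (h₁ : H.Adj u₁ v₁)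
      (h₂ : H.Adj u₂ v₂) (q₁ : H.Walk v₁ b) (q₂ : H.Walk v₂ b),
      (∀ z ∈ p₁.support, z ∈ A) → (∀ z ∈ p₂.support, z ∈ A) → v₁ ∉ A → v₂ ∉ A →
      p₁.append (SimpleGraph.Walk.cons h₁ q₁) = p₂.append (SimpleGraph.Walk.cons h₂ q₂) →
      u₁ = u₂ ∧ v₁ = v₂ ∧ HEq p₁ p₂ ∧ HEq q₁ q₂ := by
  intro a u₁ v₁ u₂ v₂ p₁
  induction p₁ generalizing u₂ with
  | nil =>
    intro p₂ h₁ h₂ q₁ q₂ _ hp₂ hv₁ _ heq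
    cases p₂ with
    | nil =>
      simp only [SimpleGraph.Walk.nil_append, SimpleGraph.Walk.cons.injEq] at heq
      obtain ⟨rfl, heq⟩ := heq
      exact ⟨rfl, rfl, HEq.rfl, heq⟩
    | cons h' r =>
      simp only [SimpleGraph.Walk.nil_append, SimpleGraph.Walk.cons_append,
        SimpleGraph.Walk.cons.injEq] at heq
      obtain ⟨rfl, -⟩ := heq
      exact absurd (hp₂ _ (by simp)) hv₁
  | @cons a c _ h' r ih =>
    intro p₂ h₁ h₂ q₁ q₂ hp₁ hp₂ hv₁ hv₂ heq
    cases p₂ with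
    | nil =>
      simp only [SimpleGraph.Walk.nil_append, SimpleGraph.Walk.cons_append,
        SimpleGraph.Walk.cons.injEq] at heq
      obtain ⟨rfl, -⟩ := heq
      exact absurd (hp₁ _ (by simp)) hv₂
    | cons h'' r' =>
      simp only [SimpleGraph.Walk.cons_append, SimpleGraph.Walk.cons.injEq] at heq
      obtain ⟨rfl, heq⟩ := heq
      obtain ⟨rfl, rfl, h3, h4⟩ := ih r' h₁ h₂ q₁ q₂ (fun z hz => hp₁ z (by simp [hz]))
        (fun z hz => hp₂ z (by simp [hz])) hv₁ hv₂ (eq_of_heq heq)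
      refine ⟨rfl, rfl, ?_, h4⟩
      rw [eq_of_heq h3]

/-- **The splitting bijection.** Under the two-edge-cut hypothesis, gluing `(p, q) ↦ p · e₁e₂ · q` and
`(p, q) ↦ p · f₁f₂ · q` is a bijection from the disjoint sum of the two products (self-avoiding paths
`a → e₁` in `GA`) × (self-avoiding paths `e₂ → b` in `GB`), resp. with `f`, onto the self-avoiding paths
`a → b` of `H`, of length `|p| + |q| + 1`. Here `GA`, `GB ≤ H` are any subgraphs containing the edges
of `H` inside `A`, resp. inside `Aᶜ`, and only edges ending in `A`, resp. in `Aᶜ`. [folklore] -/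
private theorem exists_glue {H GA GB : SimpleGraph V} {A : Set V} {e₁ e₂ f₁ f₂ a b : V}
    (hcut : ∀ u v, H.Adj u v → u ∈ A → v ∉ A → (u = e₁ ∧ v = e₂) ∨ (u = f₁ ∧ v = f₂))
    (he : H.Adj e₁ e₂) (hf : H.Adj f₁ f₂) (he₁ : e₁ ∈ A) (he₂ : e₂ ∉ A) (hf₁ : f₁ ∈ A)
    (hf₂ : f₂ ∉ A) (hef : e₁ ≠ f₁ ∨ e₂ ≠ f₂) (ha : a ∈ A) (hb : b ∉ A)
    (hAle : GA ≤ H) (hBle : GB ≤ H)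
    (hA : ∀ u v, H.Adj u v → u ∈ A → v ∈ A → GA.Adj u v) (hA' : ∀ u v, GA.Adj u v → v ∈ A)
    (hB : ∀ u v, H.Adj u v → u ∉ A → v ∉ A → GB.Adj u v) (hB' : ∀ u v, GB.Adj u v → v ∉ A) :
    ∃ g : (GA.Path a e₁ × GB.Path e₂ b) ⊕ (GA.Path a f₁ × GB.Path f₂ b) → H.Path a b,
      Function.Bijective g ∧
        ∀ s, (g s).1.length =
          Sum.elim (fun pq => pq.1.1.length + (pq.2.1.length + 1))
            (fun pq => pq.1.1.length + (pq.2.1.length + 1)) s := by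
  -- the pieces stay on their sides of the cut
  have hpA : ∀ {u : V} (p : GA.Walk a u), u ∈ A → ∀ z ∈ p.support, z ∈ A := fun p hu z hz =>
    forall_mem_support (P := fun z => z ∈ A) hA' p.reverse hu z
      (by rw [SimpleGraph.Walk.support_reverse, List.mem_reverse]; exact hz)
  have hqB : ∀ {v : V} (q : GB.Walk v b), v ∉ A → ∀ z ∈ q.support, z ∉ A := fun q hv =>
    forall_mem_support (P := fun z => z ∉ A) hB' q hv
  have hpA' : ∀ {u : V} (p : GA.Walk a u), u ∈ A →
      ∀ z ∈ (p.transfer H (edges_mem_of_le hAle p)).support, z ∈ A := by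
    intro u p hu
    rw [SimpleGraph.Walk.support_transfer]
    exact hpA p hu
  -- the glued walk is self-avoiding
  have hglue : ∀ {u v : V} (huv : H.Adj u v) (p : GA.Path a u) (q : GB.Path v b), u ∈ A → v ∉ A →
      ((p.1.transfer H (edges_mem_of_le hAle p.1)).append
        (SimpleGraph.Walk.cons huv (q.1.transfer H (edges_mem_of_le hBle q.1)))).IsPath := by
    intro u v huv p q hu hv
    rw [SimpleGraph.Walk.isPath_def, SimpleGraph.Walk.support_append, SimpleGraph.Walk.support_cons,
      List.tail_cons, SimpleGraph.Walk.support_transfer, SimpleGraph.Walk.support_transfer]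
    refine List.nodup_append.2 ⟨p.2.support_nodup, q.2.support_nodup, ?_⟩
    intro z hz z' hz' hzz'
    exact hqB q.1 hv z' hz' (hzz' ▸ hpA p.1 hu z hz)
  refine ⟨Sum.elim (fun pq => ⟨_, hglue he pq.1 pq.2 he₁ he₂⟩)
    (fun pq => ⟨_, hglue hf pq.1 pq.2 hf₁ hf₂⟩), ⟨?_, ?_⟩, ?_⟩
  · -- injective: `split_unique`, and `hef` separates the two classes
    rintro (⟨p, q⟩ | ⟨p, q⟩) (⟨p', q'⟩ | ⟨p', q'⟩) h
    · simp only [Sum.elim_inl, Subtype.mk.injEq] at h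
      obtain ⟨-, -, hp, hq⟩ := split_unique _ _ _ _ _ _ (hpA' p.1 he₁) (hpA' p'.1 he₁) he₂ he₂ h
      have hp' := congrArg SimpleGraph.Walk.edges (eq_of_heq hp)
      have hq' := congrArg SimpleGraph.Walk.edges (eq_of_heq hq)
      simp only [SimpleGraph.Walk.edges_transfer] at hp' hq'
      rw [Subtype.ext (SimpleGraph.Walk.edges_injective hp'),
        Subtype.ext (SimpleGraph.Walk.edges_injective hq')]
    · simp only [Sum.elim_inl, Sum.elim_inr, Subtype.mk.injEq] at h
      obtain ⟨hu, hv, -, -⟩ := split_unique _ _ _ _ _ _ (hpA' p.1 he₁) (hpA' p'.1 hf₁) he₂ hf₂ h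
      exact (hef.elim (fun h1 => h1 hu) fun h2 => h2 hv).elim
    · simp only [Sum.elim_inl, Sum.elim_inr, Subtype.mk.injEq] at h
      obtain ⟨hu, hv, -, -⟩ := split_unique _ _ _ _ _ _ (hpA' p.1 hf₁) (hpA' p'.1 he₁) hf₂ he₂ h
      exact (hef.elim (fun h1 => h1 hu.symm) fun h2 => h2 hv.symm).elim
    · simp only [Sum.elim_inr, Subtype.mk.injEq] at h
      obtain ⟨-, -, hp, hq⟩ := split_unique _ _ _ _ _ _ (hpA' p.1 hf₁) (hpA' p'.1 hf₁) hf₂ hf₂ h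
      have hp' := congrArg SimpleGraph.Walk.edges (eq_of_heq hp)
      have hq' := congrArg SimpleGraph.Walk.edges (eq_of_heq hq)
      simp only [SimpleGraph.Walk.edges_transfer] at hp' hq'
      rw [Subtype.ext (SimpleGraph.Walk.edges_injective hp'),
        Subtype.ext (SimpleGraph.Walk.edges_injective hq')]
  · -- surjective: `exists_split`, and `hcut` names the crossing edge
    rintro ⟨w, hw⟩
    obtain ⟨u, v, huv, p, q, hu, hv, hp, hq, rfl⟩ := exists_split hcut hAle hBle hA hB hb w hw ha
    rcases hcut u v huv hu hv with ⟨rfl, rfl⟩ | ⟨rfl, rfl⟩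
    · exact ⟨Sum.inl (⟨p, hp⟩, ⟨q, hq⟩), rfl⟩
    · exact ⟨Sum.inr (⟨p, hp⟩, ⟨q, hq⟩), rfl⟩
  · -- lengths
    rintro (⟨p, q⟩ | ⟨p, q⟩) <;>
      simp only [Sum.elim_inl, Sum.elim_inr, SimpleGraph.Walk.length_append,
        SimpleGraph.Walk.length_cons, SimpleGraph.Walk.length_transfer]

/-! ## Summation -/

/-- `Σ_{(p,q)} c · (x^{|p|} x^{|q|}) = c · Z(a,u) · Z(v,b)` for the product of two path types
(`ENNReal.tsum_mul_left`, `ENNReal.tsum_prod'`, `ENNReal.tsum_mul_right`). [folklore] -/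
private theorem tsum_mul_prod_pathKernel (G₁ G₂ : SimpleGraph V) (x : ℝ) (c : ℝ≥0∞)
    (a u v b : V) :
    ∑' pq : G₁.Path a u × G₂.Path v b,
        c * (ENNReal.ofReal (x ^ pq.1.1.length) * ENNReal.ofReal (x ^ pq.2.1.length)) =
      c * (pathKernel G₁ x a u * pathKernel G₂ x v b) := by
  rw [ENNReal.tsum_mul_left, ENNReal.tsum_prod', pathKernel, pathKernel, ← ENNReal.tsum_mul_right]
  congr 1
  refine tsum_congr fun p => ?_
  rw [← ENNReal.tsum_mul_left]

/-- **Two-edge cut factorisation of the self-avoiding path kernel** (registered stub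
`stub_twoEdgeCut_factor` of the line `Sketch` of crux `BoundaryTP2`). If the only edges of `H` oriented
from `A` to `Aᶜ` are `e₁e₂` and `f₁f₂` (distinct as oriented edges, possibly sharing one endpoint), then
for `a ∈ A`, `b ∉ A` and `0 ≤ x`,
`Z_H(a,b) = x · (Z_A(a,e₁) Z_{Aᶜ}(e₂,b) + Z_A(a,f₁) Z_{Aᶜ}(f₂,b))`,
where `Z_A`, `Z_{Aᶜ}` are the path kernels of `SimpleGraph.fromRel (H.Adj u v ∧ u ∈ A ∧ v ∈ A)` and
`SimpleGraph.fromRel (H.Adj u v ∧ u ∉ A ∧ v ∉ A)`: every self-avoiding `a → b` path crosses the cut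
exactly once and splits uniquely there (`exists_glue`). All sums are unconditional sums in `ℝ≥0∞`.
[folklore] -/
theorem stub_twoEdgeCut_factor (H : SimpleGraph V) (x : ℝ) (hx : 0 ≤ x) (A : Set V)
    (e₁ e₂ f₁ f₂ a b : V)
    (hcut : ∀ u v, H.Adj u v → u ∈ A → v ∉ A → (u = e₁ ∧ v = e₂) ∨ (u = f₁ ∧ v = f₂))
    (he : H.Adj e₁ e₂) (hf : H.Adj f₁ f₂) (he₁ : e₁ ∈ A) (he₂ : e₂ ∉ A) (hf₁ : f₁ ∈ A)
    (hf₂ : f₂ ∉ A) (hef : e₁ ≠ f₁ ∨ e₂ ≠ f₂) (ha : a ∈ A) (hb : b ∉ A) :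
    pathKernel H x a b = ENNReal.ofReal x *
      (pathKernel (SimpleGraph.fromRel fun u v => H.Adj u v ∧ u ∈ A ∧ v ∈ A) x a e₁ *
          pathKernel (SimpleGraph.fromRel fun u v => H.Adj u v ∧ u ∉ A ∧ v ∉ A) x e₂ b +
        pathKernel (SimpleGraph.fromRel fun u v => H.Adj u v ∧ u ∈ A ∧ v ∈ A) x a f₁ *
          pathKernel (SimpleGraph.fromRel fun u v => H.Adj u v ∧ u ∉ A ∧ v ∉ A) x f₂ b) := by
  set GA := SimpleGraph.fromRel fun u v => H.Adj u v ∧ u ∈ A ∧ v ∈ A with hGA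
  set GB := SimpleGraph.fromRel fun u v => H.Adj u v ∧ u ∉ A ∧ v ∉ A with hGB
  -- the two side graphs: subgraphs of `H` containing the internal edges, with edges ending on their side
  have hAle : GA ≤ H := by
    intro u v h
    rw [hGA, SimpleGraph.fromRel_adj] at h
    rcases h with ⟨-, h | h⟩
    exacts [h.1, h.1.symm]
  have hBle : GB ≤ H := by
    intro u v h
    rw [hGB, SimpleGraph.fromRel_adj] at h
    rcases h with ⟨-, h | h⟩
    exacts [h.1, h.1.symm]
  have hA : ∀ u v, H.Adj u v → u ∈ A → v ∈ A → GA.Adj u v := fun u v h hu hv => by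
    rw [hGA, SimpleGraph.fromRel_adj]
    exact ⟨h.ne, Or.inl ⟨h, hu, hv⟩⟩
  have hB : ∀ u v, H.Adj u v → u ∉ A → v ∉ A → GB.Adj u v := fun u v h hu hv => by
    rw [hGB, SimpleGraph.fromRel_adj]
    exact ⟨h.ne, Or.inl ⟨h, hu, hv⟩⟩
  have hA' : ∀ u v, GA.Adj u v → v ∈ A := by
    intro u v h
    rw [hGA, SimpleGraph.fromRel_adj] at h
    rcases h with ⟨-, h | h⟩
    exacts [h.2.2, h.2.1]
  have hB' : ∀ u v, GB.Adj u v → v ∉ A := by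
    intro u v h
    rw [hGB, SimpleGraph.fromRel_adj] at h
    rcases h with ⟨-, h | h⟩
    exacts [h.2.2, h.2.1]
  -- the splitting bijection and the resulting change of variables in the kernel
  obtain ⟨g, hg, hlen⟩ := exists_glue hcut he hf he₁ he₂ hf₁ hf₂ hef ha hb hAle hBle hA hA' hB hB'
  have hsum : pathKernel H x a b = ∑' s, ENNReal.ofReal (x ^ (g s).1.length) :=
    (hg.1.tsum_eq (f := fun γ : H.Path a b => ENNReal.ofReal (x ^ γ.1.length)) fun γ _ => hg.2 γ).symm
  have hterm : ∀ s, ENNReal.ofReal (x ^ (g s).1.length) =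
      Sum.elim
        (fun pq : GA.Path a e₁ × GB.Path e₂ b => ENNReal.ofReal x *
          (ENNReal.ofReal (x ^ pq.1.1.length) * ENNReal.ofReal (x ^ pq.2.1.length)))
        (fun pq : GA.Path a f₁ × GB.Path f₂ b => ENNReal.ofReal x *
          (ENNReal.ofReal (x ^ pq.1.1.length) * ENNReal.ofReal (x ^ pq.2.1.length))) s := by
    rintro (pq | pq) <;> simp only [hlen, Sum.elim_inl, Sum.elim_inr] <;>
      rw [pow_add, pow_succ, ENNReal.ofReal_mul (pow_nonneg hx _),
        ENNReal.ofReal_mul (pow_nonneg hx _)] <;> ring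
  rw [hsum, tsum_congr hterm, Summable.tsum_sum ENNReal.summable ENNReal.summable]
  simp only [Sum.elim_inl, Sum.elim_inr]
  rw [tsum_mul_prod_pathKernel, tsum_mul_prod_pathKernel, ← mul_add]

end Summit.CriticalPhenomena.SAWScalingLimit.Theorems.BoundaryTP2
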